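import Summits.QuantumFields.GaugeBoot.Certificates.SparseReducedWindowE
import HarnessLib

/-!
# Sparse certificate replay, part 5d: early-exit window sweep with OFFSET TABLES (and the cheaper skip test)

HONEST FRAMING (cell `pub-gaugeboot`): certified bounds on lattice expectations at stated coupling,
gauge group, dimension and torus size; NOT a mass gap, NOT a continuum limit, NOT a string tension;
NOT Yang–Mills-summit-bearing (barriers `FixedCouplingUltralocality`, `PerturbativeInvisibility`).

Sequel of part 5c (`SparseReducedWindowE.lean`).  Two refinements of the early-exit walk, both `[folklore]`, both ending
in the SAME window statement `WinOK` of part 5b: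

* SKIP TEST FIRST (`accTermsH`): a stored term `(v, c)` below the window (`v < lo`) is skipped after ONE comparison
  (`Nat.ble lo v = false`); only terms `v ≥ lo` are compared with `hi` (insert while `v < hi`, stop at the first `v ≥ hi`).
  Farm measurements (lean3 gen 7, 2026-08-22, family `KZL2rpD4`): a skipped term costs ≈ 35 µs with two comparisons; the
  late windows of a certificate skip ≈ 4·10⁵ terms each.
* OFFSET TABLES (`winCheckH … H lo hi s`): a window `lo ≤ v < hi` with `H ≤ lo` may be swept over a family-level literal copy
  `EBH` of the entry tables restricted to `H ≤ v < N` with keys shifted by `H` (`EBH = EBshift H N EB`, one kernel equality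
  check per family table), so that the terms below `H` are never visited (`EBshift_comp`: shifting by `H` and then by
  `lo − H` is shifting by `lo`).  `H = 0`, `EBH = EB` is the plain case (`winOK_of_checkH0`).
Soundness (`winOK_of_checkH`) is again a transfer to the part-5 sweep `sweepR` on `EBshift lo hi EB` (`sweepH_eq`).
Nothing here is specific to lattice gauge theory.
-/

namespace Summit.QuantumFields.GaugeBoot.Certificates.Sparse

open Matrix Finset Literature.Computation.Certificates

noncomputable section

/-! ## Shifting twice -/

/-- Shifting by `H` (window `H ≤ v < N`) and then by `a` (window `a ≤ v' < b`, `H + b ≤ N`) is shifting by `H + a`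
(window `H + a ≤ v < H + b`). [folklore] -/
theorem shiftFilter_comp (H N a b : ℕ) (hN : H + b ≤ N) :
    ∀ L : List (ℕ × ℤ), shiftFilter a b (shiftFilter H N L) = shiftFilter (H + a) (H + b) L
  | [] => rfl
  | (w, c) :: L => by
    rw [shiftFilter, shiftFilter]
    by_cases h : H ≤ w ∧ w < N
    · rw [if_pos h, shiftFilter, shiftFilter_comp H N a b hN L]
      by_cases h' : a ≤ w - H ∧ w - H < b
      · rw [if_pos h', if_pos (by omega), show w - H - a = w - (H + a) by omega]
      · rw [if_neg h', if_neg (by omega)]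
    · rw [if_neg h, shiftFilter_comp H N a b hN L, if_neg (by omega)]

/-- The same for whole tables. [folklore] -/
theorem EBshift_comp (H N a b : ℕ) (hN : H + b ≤ N) (EB : List (List (List (List (ℕ × ℤ))))) :
    EBshift a b (EBshift H N EB) = EBshift (H + a) (H + b) EB := by
  unfold EBshift blkShift rowShift
  rw [List.map_map]
  refine List.map_congr_left fun blk _ => ?_
  rw [Function.comp_apply, List.map_map]
  refine List.map_congr_left fun row _ => ?_
  rw [Function.comp_apply, List.map_map]
  exact List.map_congr_left fun e _ => by rw [Function.comp_apply, shiftFilter_comp H N a b hN]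

/-- `blkShift` distributes over concatenation of row chunks (used to assemble offset tables part by part). [folklore] -/
theorem blkShift_append (H N : ℕ) (X Y : List (List (List (ℕ × ℤ)))) :
    blkShift H N (X ++ Y) = blkShift H N X ++ blkShift H N Y := by
  unfold blkShift; rw [List.map_append]

/-- `EBshift` distributes over concatenation of block chunks. [folklore] -/
theorem EBshift_append (H N : ℕ) (X Y : List (List (List (List (ℕ × ℤ))))) :
    EBshift H N (X ++ Y) = EBshift H N X ++ EBshift H N Y := by
  unfold EBshift; rw [List.map_append]

/-- `EBshift` of a singleton block list. [folklore] -/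
theorem EBshift_singleton (H N : ℕ) (blk : List (List (List (ℕ × ℤ)))) :
    EBshift H N [blk] = [blkShift H N blk] := rfl

/-- `EBshift` as a block-wise map (for whole-block data parts). [folklore] -/
theorem EBshift_eq_map (H N : ℕ) (X : List (List (List (List (ℕ × ℤ))))) : EBshift H N X = X.map (blkShift H N) := rfl

/-- Shifting preserves sortedness of a combination. [folklore] -/
theorem sortedFrom_shiftFilter (H N : ℕ) : ∀ (L : List (ℕ × ℤ)) (b : ℕ), sortedFrom L b = true →
    sortedFrom (shiftFilter H N L) (b - H) = true
  | [], _, _ => rfl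
  | (w, c) :: L, b, h => by
    rw [sortedFrom_cons, Bool.and_eq_true, Nat.ble_eq] at h
    rw [shiftFilter]
    by_cases hw : H ≤ w ∧ w < N
    · rw [if_pos hw, sortedFrom_cons, Bool.and_eq_true, Nat.ble_eq]
      refine ⟨by omega, ?_⟩
      rw [show w - H + 1 = (w + 1) - H by omega]
      exact sortedFrom_shiftFilter H N L (w + 1) h.2
    · rw [if_neg hw]
      exact sortedFrom_mono _ (by omega) (sortedFrom_shiftFilter H N L (w + 1) h.2)

/-- Shifting preserves the family-level sortedness check. [folklore] -/
theorem sortedCheck_EBshift (H N : ℕ) {EB : List (List (List (List (ℕ × ℤ))))} (h : sortedCheck EB = true) :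
    sortedCheck (EBshift H N EB) = true := by
  unfold sortedCheck at h ⊢
  unfold EBshift blkShift rowShift
  rw [List.all_eq_true] at h ⊢
  intro blk' hblk'
  obtain ⟨blk, hblk, rfl⟩ := List.mem_map.mp hblk'
  have h1 := List.all_eq_true.mp (h blk hblk)
  rw [List.all_eq_true]
  intro row' hrow'
  obtain ⟨row, hrow, rfl⟩ := List.mem_map.mp hrow'
  have h2 := List.all_eq_true.mp (h1 row hrow)
  rw [List.all_eq_true]
  intro e' he'
  obtain ⟨e, he, rfl⟩ := List.mem_map.mp he'
  have h3 := h2 e he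
  simpa using sortedFrom_shiftFilter H N e 0 h3

/-! ## Kernel-side walk, skip test first -/

/-- Early-exit shifted term walk, SKIP TEST FIRST: a term with `v < lo` is skipped after one comparison; for `v ≥ lo`,
insert `c · wt` at key `v − lo` while `v < hi`, stop at the first `v ≥ hi`. [folklore] -/
def accTermsH (d lo hi : ℕ) (wt : ℤ) (L : List (ℕ × ℤ)) : Trie → Trie :=
  @List.rec (ℕ × ℤ) (fun _ => Trie → Trie) (fun t => t)
    (fun p _ ih t => bif Nat.ble lo p.1 then
        (bif Nat.blt p.1 hi then ih (Trie.addL d t (Nat.sub p.1 lo) (Int.mul p.2 wt)) else t)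
      else ih t) L

/-- Unfolding `accTermsH` on a `cons`. [folklore] -/
theorem accTermsH_cons (d lo hi : ℕ) (wt : ℤ) (w : ℕ) (c : ℤ) (L : List (ℕ × ℤ)) (t : Trie) :
    accTermsH d lo hi wt ((w, c) :: L) t =
      (bif Nat.ble lo w then
        (bif Nat.blt w hi then accTermsH d lo hi wt L (Trie.addL d t (w - lo) (Int.mul c wt)) else t)
      else accTermsH d lo hi wt L t) := rfl

/-- `accTermsH` is the part-5 walk of the shifted-and-filtered combination over `0 ≤ v' < hi − lo`. [folklore] -/
theorem accTermsH_eq (d lo hi : ℕ) (wt : ℤ) : ∀ (L : List (ℕ × ℤ)) (b : ℕ) (t : Trie), sortedFrom L b = true →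
    accTermsH d lo hi wt L t = accTermsR d 0 (hi - lo) wt (shiftFilter lo hi L) t
  | [], _, _, _ => rfl
  | (w, c) :: L, b, t, hs => by
    rw [sortedFrom_cons, Bool.and_eq_true] at hs
    rw [accTermsH_cons, shiftFilter]
    by_cases hl : lo ≤ w
    · rw [Nat.ble_eq.mpr hl, cond_true]
      by_cases hw : w < hi
      · rw [Nat.blt_eq.mpr hw, cond_true, if_pos ⟨hl, hw⟩, accTermsR_cons,
          show (Nat.ble 0 (w - lo) && Nat.blt (w - lo) (hi - lo)) = true by
            rw [Bool.and_eq_true, Nat.ble_eq, Nat.blt_eq]; omega,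
          cond_true, Trie.addL_eq, Trie.addR_eq, accTermsH_eq d lo hi wt L (w + 1) _ hs.2]
      · have hb : Nat.blt w hi = false := by rw [Bool.eq_false_iff, ne_eq, Nat.blt_eq]; exact hw
        rw [hb, cond_false, if_neg (fun h => hw h.2), shiftFilter_eq_nil L hs.2 (by omega)]
        rfl
    · have hb : Nat.ble lo w = false := by rw [Bool.eq_false_iff, ne_eq, Nat.ble_eq]; exact hl
      rw [hb, cond_false, if_neg (fun h => hl h.1), accTermsH_eq d lo hi wt L (w + 1) _ hs.2]

/-- Row walk (raw dot product, `accTermsH`). [folklore] -/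
def accRowH (d lo hi : ℕ) (Gi : List ℤ) (es : List (List (ℕ × ℤ))) : Bool → List (List ℤ) → Trie → Trie :=
  @List.rec (List (ℕ × ℤ)) (fun _ => Bool → List (List ℤ) → Trie → Trie) (fun _ _ t => t)
    (fun e _ ih first Gs t =>
      ih false Gs.tail (accTermsH d lo hi (Int.mul (bif first then 1 else 2) (listDotR Gi (Gs.headD []))) e t)) es

/-- Unfolding `accRowH` on a `cons`. [folklore] -/
theorem accRowH_cons (d lo hi : ℕ) (Gi : List ℤ) (e : List (ℕ × ℤ)) (es : List (List (ℕ × ℤ))) (first : Bool)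
    (Gs : List (List ℤ)) (t : Trie) : accRowH d lo hi Gi (e :: es) first Gs t =
      accRowH d lo hi Gi es false Gs.tail
        (accTermsH d lo hi (Int.mul (bif first then 1 else 2) (listDotR Gi (Gs.headD []))) e t) := rfl

/-- `accRowH` is the part-5 row walk of the shifted row. [folklore] -/
theorem accRowH_eq (d lo hi : ℕ) (Gi : List ℤ) : ∀ (es : List (List (ℕ × ℤ))) (first : Bool) (Gs : List (List ℤ))
    (t : Trie), (∀ e ∈ es, sortedFrom e 0 = true) →
    accRowH d lo hi Gi es first Gs t = accRowR d 0 (hi - lo) Gi (es.map (shiftFilter lo hi)) first Gs t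
  | [], _, _, _, _ => rfl
  | e :: es, first, Gs, t, hs => by
    rw [accRowH_cons, List.map_cons, accRowR_cons, listDotR_eq,
      accTermsH_eq d lo hi _ e 0 t (hs e (by simp)),
      accRowH_eq d lo hi Gi es false Gs.tail _ fun e' he' => hs e' (by simp [he'])]

/-- Row loop of block `k`. [folklore] -/
def accIH (GB : List (List (List ℤ))) (EB : List (List (List (List (ℕ × ℤ))))) (d lo hi k : ℕ) (n : ℕ) :
    Trie → Trie :=
  @Nat.rec (fun _ => Trie → Trie) (fun t => t)
    (fun i ih t => ih (accRowH d lo hi (grow GB k i) ((EB.getD k []).getD i []) true ((GB.getD k []).drop i) t)) n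

/-- Unfolding `accIH`. [folklore] -/
theorem accIH_succ (GB : List (List (List ℤ))) (EB : List (List (List (List (ℕ × ℤ))))) (d lo hi k i : ℕ)
    (t : Trie) : accIH GB EB d lo hi k (i + 1) t =
      accIH GB EB d lo hi k i (accRowH d lo hi (grow GB k i) ((EB.getD k []).getD i []) true ((GB.getD k []).drop i) t) :=
  rfl

/-- `accIH` is the part-5 row loop on the shifted table. [folklore] -/
theorem accIH_eq (GB : List (List (List ℤ))) {EB : List (List (List (List (ℕ × ℤ))))} (hs : sortedCheck EB = true)
    (d lo hi k : ℕ) : ∀ (n : ℕ) (t : Trie),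
    accIH GB EB d lo hi k n t = accIR GB (EBshift lo hi EB) d 0 (hi - lo) k n t
  | 0, _ => rfl
  | i + 1, t => by
    rw [accIH_succ, accIR_succ, getD_EBshift, accRowH_eq d lo hi _ _ _ _ _ (sorted_of_check hs k i),
      accIH_eq GB hs d lo hi k i]

/-- Block loop. [folklore] -/
def accKH (GB : List (List (List ℤ))) (EB : List (List (List (List (ℕ × ℤ))))) (d lo hi m : ℕ) (n : ℕ) :
    Trie → Trie :=
  @Nat.rec (fun _ => Trie → Trie) (fun t => t) (fun k ih t => ih (accIH GB EB d lo hi k m t)) n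

/-- Unfolding `accKH`. [folklore] -/
theorem accKH_succ (GB : List (List (List ℤ))) (EB : List (List (List (List (ℕ × ℤ))))) (d lo hi m k : ℕ)
    (t : Trie) : accKH GB EB d lo hi m (k + 1) t = accKH GB EB d lo hi m k (accIH GB EB d lo hi k m t) := rfl

/-- `accKH` is the part-5 block loop on the shifted table. [folklore] -/
theorem accKH_eq (GB : List (List (List ℤ))) {EB : List (List (List (List (ℕ × ℤ))))} (hs : sortedCheck EB = true)
    (d lo hi m : ℕ) : ∀ (n : ℕ) (t : Trie),
    accKH GB EB d lo hi m n t = accKR GB (EBshift lo hi EB) d 0 (hi - lo) m n t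
  | 0, _ => rfl
  | k + 1, t => by rw [accKH_succ, accKR_succ, accIH_eq GB hs, accKH_eq GB hs d lo hi m k]

/-- **The early-exit sweep, skip test first** (kernel side). [folklore] -/
def sweepH (GB : List (List (List ℤ))) (EB : List (List (List (List (ℕ × ℤ))))) (nb m d lo hi : ℕ) : Trie :=
  accKH GB EB d lo hi m nb Trie.nil

/-- `sweepH` is the part-5 sweep of the shifted table over `0 ≤ v' < hi − lo`. [folklore] -/
theorem sweepH_eq (GB : List (List (List ℤ))) {EB : List (List (List (List (ℕ × ℤ))))} (hs : sortedCheck EB = true)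
    (nb m d lo hi : ℕ) : sweepH GB EB nb m d lo hi = sweepR GB (EBshift lo hi EB) nb m d 0 (hi - lo) :=
  accKH_eq GB hs d lo hi m nb Trie.nil

/-- **Sweep semantics through an offset table**: if `EBH = EBshift H N EB` (keys `H ≤ v < N`, shifted by `H`), then the
sweep of `EBH` over the shifted window `lo − H ≤ v' < hi − H` accumulates, at key `v'`, `trZ EB (lo + v')`
(`H ≤ lo`, `hi ≤ N`). [folklore] -/
theorem getR_sweepH {GB : List (List (List ℤ))} {EB EBH : List (List (List (List (ℕ × ℤ))))} {nb m d H N lo hi : ℕ}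
    (hEBH : EBH = EBshift H N EB) (hsortH : sortedCheck EBH = true) (hrow : rowLenCheck EB m nb = true)
    (hH : H ≤ lo) (hlh : lo ≤ hi) (hN : hi ≤ N) (hd : hi - lo ≤ 2 ^ d) {v' : ℕ} (hv : v' < hi - lo) :
    (sweepH GB EBH nb m d (lo - H) (hi - H)).getR d v' = trZ GB EB nb m (lo + v') := by
  have hwin : EBshift (lo - H) (hi - H) EBH = EBshift lo hi EB := by
    rw [hEBH, EBshift_comp H N (lo - H) (hi - H) (by omega), show H + (lo - H) = lo by omega,
      show H + (hi - H) = hi by omega]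
  rw [sweepH_eq GB hsortH, hwin, show hi - H - (lo - H) = hi - lo by omega,
    getR_sweepR (by rw [rowLenCheck_EBshift]; exact hrow) hd (Nat.zero_le _) hv, trZ_shift GB EB nb m lo hi hv]

/-! ## Window check with an offset table -/

/-- **Window check (early exit, skip test first, offset table)**: `H ≤ lo ≤ hi`, `hi − lo ≤ 2^d`, sweep of the offset table
`EBH` over the shifted window, residual walk on the GLOBAL indices `lo ≤ v < hi` (trie key `v − lo`), comparison with the
emitted integer `s`.  With `H = 0` and `EBH = EB` this is the plain early-exit check. [folklore] -/
def winCheckH (GB : List (List (List ℤ))) (EBH : List (List (List (List (ℕ × ℤ))))) (nb m d : ℕ)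
    (cZ : List (ℕ × ℤ)) (RN : List ℤ) (P D : ℤ) (H lo hi : ℕ) (s : ℤ) : Bool :=
  decide (H ≤ lo) && decide (lo ≤ hi) && decide (hi - lo ≤ 2 ^ d) &&
    decide (resWalkE d lo (sweepH GB EBH nb m d (lo - H) (hi - H)) cZ P D (hi - lo) (RN.drop lo) lo 0 = s)

/-- **Soundness of `winCheckH`** for an offset table `EBH = EBshift H N EB` with `hi ≤ N`: the SAME `WinOK` as part 5b.
[folklore] -/
theorem winOK_of_checkH {GB : List (List (List ℤ))} {EB EBH : List (List (List (List (ℕ × ℤ))))} {nb m d : ℕ}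
    {cZ : List (ℕ × ℤ)} {RN : List ℤ} {P D : ℤ} {H N lo hi : ℕ} {s : ℤ} (hEBH : EBH = EBshift H N EB) (hN : hi ≤ N)
    (hsortH : sortedCheck EBH = true) (hrow : rowLenCheck EB m nb = true)
    (h : winCheckH GB EBH nb m d cZ RN P D H lo hi s = true) : WinOK GB EB nb m cZ RN P D lo hi s := by
  rw [winCheckH, Bool.and_eq_true, Bool.and_eq_true, Bool.and_eq_true, decide_eq_true_eq, decide_eq_true_eq,
    decide_eq_true_eq, decide_eq_true_eq] at h
  obtain ⟨⟨⟨hH, hlh⟩, hd⟩, hs⟩ := h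
  refine ⟨hlh, ?_⟩
  rw [← hs, resWalkE_eq, zero_add]
  refine Finset.sum_congr rfl fun i hi' => ?_
  rw [Finset.mem_range] at hi'
  rw [show lo + i - lo = i by omega, getR_sweepH hEBH hsortH hrow hH hlh hN hd hi', gZ_eq]

/-- **Soundness of `winCheckH` with the family table itself** (`H = 0`). [folklore] -/
theorem winOK_of_checkH0 {GB : List (List (List ℤ))} {EB : List (List (List (List (ℕ × ℤ))))} {nb m d : ℕ}
    {cZ : List (ℕ × ℤ)} {RN : List ℤ} {P D : ℤ} {lo hi : ℕ} {s : ℤ}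
    (hsort : sortedCheck EB = true) (hrow : rowLenCheck EB m nb = true)
    (h : winCheckH GB EB nb m d cZ RN P D 0 lo hi s = true) : WinOK GB EB nb m cZ RN P D lo hi s := by
  rw [winCheckH, Bool.and_eq_true, Bool.and_eq_true, Bool.and_eq_true, decide_eq_true_eq, decide_eq_true_eq,
    decide_eq_true_eq, decide_eq_true_eq] at h
  obtain ⟨⟨⟨_, hlh⟩, hd⟩, hs⟩ := h
  refine ⟨hlh, ?_⟩
  rw [← hs, resWalkE_eq, zero_add]
  refine Finset.sum_congr rfl fun i hi' => ?_
  rw [Finset.mem_range] at hi'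
  rw [show lo + i - lo = i by omega, Nat.sub_zero, Nat.sub_zero, sweepH_eq GB hsort,
    getR_sweepR (by rw [rowLenCheck_EBshift]; exact hrow) hd (Nat.zero_le _) hi', trZ_shift GB EB nb m lo hi hi', gZ_eq]

end

end Summit.QuantumFields.GaugeBoot.Certificates.Sparse
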